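import Literature.Probability.Percolation.FourArmGarbanCircuitBits
import Literature.Probability.LatticeModels.MedialInterface
import Mathlib.Analysis.Complex.ReImTopology
import HarnessLib

/-!
# Garban's square as an admissible discrete Dobrushin domain (lattice squares at mesh `1`)

Topic `Literature/Probability/Percolation`; support file for the named fact
`Garban2011_fourArm_multiscale` (`FourArmGarban.lean`; C. Garban, Appendix B of O. Schramm,
S. Smirnov, Ann. Probab. 39 (2011), Lemma B.1). Garban: "Consider `Q` with open boundary
conditions on the side `∂₀Q` and dual closed on the complementary three sides. Let `γ` be the
interface running between the two ends of the side `∂₀Q`". This file realises `Q` as discrete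
Dobrushin data for the tree's medial exploration (`MedialInterface.lean`): the open square
`Ω_L = (-1/2, L+1/2)²` at mesh `δ = 1`, whose mesh vertices are the sites `{0, …, L}²`, with the
wired arc `A` the left side of `∂Ω_L` extended by two hooks of length one along the bottom and
top sides (so that no boundary site is equidistant from the two arcs: the tie-freeness required
by `IsZdAdmissible`, cf. `CanonicalDiscretisationTies.lean`), and the dual-wired arc
`B = ∂Ω_L ∖ A`. Part 1 (this file): the lattice structure — mesh vertices, the discrete domain
(`meshDomain = meshVertices` for a connected mesh graph), inner faces, the discrete boundary.

## References

* O. Schramm, S. Smirnov (appendix by C. Garban), Ann. Probab. 39 (2011), Appendix B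
  [SchrammSmirnov2011].
* S. Smirnov, C. R. Acad. Sci. Paris 333 (2001), §2 (discrete domains, exploration)
  [Smirnov2001].
-/

noncomputable section

namespace Literature.Probability.Percolation

open _root_.MeasureTheory Set Metric LatticeModels LatticeModels.DiscreteDobrushin _root_.Complex

/-! ### A connected mesh graph has a single component: `meshDomain = meshVertices` -/

/-- If the mesh graph on the mesh vertices is preconnected, the discrete domain is the whole set
of mesh vertices (there is a single connected component). (The same statement is proved as
`Literature.Barriers.CriticalPhenomena.NoVertexRelation.meshDomain_eq_of_preconnected` in a
barrier file; reproved here rather than importing a `Barriers/` module into the percolation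
library.) [folklore] -/
theorem meshDomain_eq_meshVertices_of_preconnected {Ω : Set ℂ} {δ : ℝ}
    (h : (meshVertexGraph Ω δ).Preconnected) : meshDomain Ω δ = meshVertices Ω δ := by
  refine Set.Subset.antisymm (meshDomain_subset_meshVertices Ω δ) fun x hx => ?_
  simp only [meshDomain, Set.mem_iUnion, Set.mem_image]
  refine ⟨(meshVertexGraph Ω δ).connectedComponentMk ⟨x, hx⟩, fun C' => ?_, ⟨x, hx⟩,
    (SimpleGraph.ConnectedComponent.mem_supp_iff _ _).2 rfl, rfl⟩
  induction C' using SimpleGraph.ConnectedComponent.ind with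
  | h v =>
    rw [SimpleGraph.ConnectedComponent.sound (h v ⟨x, hx⟩)]

/-! ### The square `Ω_L` and its sites -/

/-- Garban's square as a planar domain: the open square `(-1/2, L + 1/2)²`, whose lattice points
are the sites `{0, …, L}²`. [cite: SchrammSmirnov2011, Appendix B, proof of Lemma B.1 (the square Q)] -/
def squareDomain (L : ℕ) : Set ℂ :=
  Set.Ioo (-(1 / 2 : ℝ)) (L + 1 / 2) ×ℂ Set.Ioo (-(1 / 2 : ℝ)) (L + 1 / 2)

/-- The sites of the square: `{0, …, L}²`. [folklore] -/
def squareSites (L : ℕ) : Set (Site 2) :=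
  {x | ∀ i, 0 ≤ x i ∧ x i ≤ L}

/-- Membership in `squareSites`, unfolded. [folklore] -/
@[simp] theorem mem_squareSites_iff {L : ℕ} {x : Site 2} :
    x ∈ squareSites L ↔ ∀ i, 0 ≤ x i ∧ x i ≤ L := Iff.rfl

/-- An integer lies in `(-1/2, L + 1/2)` iff it lies in `[0, L]`. [folklore] -/
theorem int_mem_Ioo_half_iff (a : ℤ) (L : ℕ) :
    (a : ℝ) ∈ Set.Ioo (-(1 / 2 : ℝ)) (L + 1 / 2) ↔ 0 ≤ a ∧ a ≤ L := by
  rw [Set.mem_Ioo]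
  constructor
  · rintro ⟨h1, h2⟩
    constructor
    · by_contra h
      have : (a : ℝ) ≤ -1 := by exact_mod_cast (show a ≤ -1 by omega)
      linarith
    · by_contra h
      have : (L : ℝ) + 1 ≤ a := by exact_mod_cast (show (L : ℤ) + 1 ≤ a by omega)
      linarith
  · rintro ⟨h1, h2⟩
    have h1' : (0 : ℝ) ≤ a := by exact_mod_cast h1
    have h2' : (a : ℝ) ≤ L := by exact_mod_cast h2
    constructor <;> linarith

/-- **The mesh vertices of the square at mesh `1` are the sites `{0, …, L}²`.** [folklore] -/
theorem meshVertices_squareDomain (L : ℕ) : meshVertices (squareDomain L) 1 = squareSites L := by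
  ext x
  rw [mem_meshVertices_iff, squareDomain, mem_reProdIm, meshPoint_re, meshPoint_im, one_mul,
    one_mul, int_mem_Ioo_half_iff, int_mem_Ioo_half_iff, mem_squareSites_iff, Fin.forall_fin_two]

/-- The square is convex. [folklore] -/
theorem convex_squareDomain (L : ℕ) : Convex ℝ (squareDomain L) :=
  ((convex_Ioo _ _).linear_preimage reLm).inter ((convex_Ioo _ _).linear_preimage imLm)

/-- The square is bounded. [folklore] -/
theorem isBounded_squareDomain (L : ℕ) : Bornology.IsBounded (squareDomain L) := by
  refine (Metric.isBounded_closedBall (x := (0 : ℂ)) (r := 2 * ((L : ℝ) + 1))).subset ?_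
  intro z hz
  rw [squareDomain, mem_reProdIm, Set.mem_Ioo, Set.mem_Ioo] at hz
  rw [Metric.mem_closedBall, dist_zero_right]
  have hre : |z.re| ≤ (L : ℝ) + 1 := abs_le.2 ⟨by linarith [hz.1.1], by linarith [hz.1.2]⟩
  have him : |z.im| ≤ (L : ℝ) + 1 := abs_le.2 ⟨by linarith [hz.2.1], by linarith [hz.2.2]⟩
  calc ‖z‖ ≤ |z.re| + |z.im| := Complex.norm_le_abs_re_add_abs_im z
    _ ≤ 2 * ((L : ℝ) + 1) := by linarith

/-- **Lattice neighbours inside the square are mesh-adjacent** (the unit segment joining them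
stays in the convex square). [folklore] -/
theorem meshGraph_adj_of_mem_squareSites {L : ℕ} {x y : Site 2} (hx : x ∈ squareSites L)
    (hy : y ∈ squareSites L) (hxy : (zdGraph 2).Adj x y) : (meshGraph (squareDomain L) 1).Adj x y := by
  refine meshGraph_adj_iff.2 ⟨hxy, ?_⟩
  have hx' : meshPoint 1 x ∈ squareDomain L := by
    rw [← mem_meshVertices_iff, meshVertices_squareDomain]; exact hx
  have hy' : meshPoint 1 y ∈ squareDomain L := by
    rw [← mem_meshVertices_iff, meshVertices_squareDomain]; exact hy
  exact ((convex_squareDomain L).segment_subset hx' hy').trans subset_closure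

/-- The site `(i, j)` lies in the square iff `0 ≤ i, j ≤ L`. [folklore] -/
theorem pt_mem_squareSites_iff {L : ℕ} {i j : ℤ} :
    pt i j ∈ squareSites L ↔ (0 ≤ i ∧ i ≤ L) ∧ (0 ≤ j ∧ j ≤ L) := by
  simp [squareSites, Fin.forall_fin_two, pt]

/-- `(i, j + 1) = (i, j) + e₁`. [folklore] -/
theorem pt_succ_eq' (i j : ℤ) : pt i (j + 1) = pt i j + Pi.single 1 1 := by
  ext k; fin_cases k <;> simp [pt]

/-- **The mesh graph of the square is connected**: every site of the square is joined to the
corner `(0, 0)` along the bottom row and then its column. [folklore] -/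
theorem meshVertexGraph_squareDomain_preconnected (L : ℕ) :
    (meshVertexGraph (squareDomain L) 1).Preconnected := by
  have hV : meshVertices (squareDomain L) 1 = squareSites L := meshVertices_squareDomain L
  set G := meshVertexGraph (squareDomain L) 1 with hG
  have h00 : pt 0 0 ∈ meshVertices (squareDomain L) 1 := by
    rw [hV, pt_mem_squareSites_iff]; omega
  -- along the bottom row
  have hrow : ∀ k : ℕ, (hk : k ≤ L) →
      ∃ h : pt k 0 ∈ meshVertices (squareDomain L) 1, G.Reachable ⟨pt 0 0, h00⟩ ⟨pt k 0, h⟩ := by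
    intro k hk
    induction k with
    | zero => exact ⟨by exact_mod_cast h00, by exact_mod_cast SimpleGraph.Reachable.refl _⟩
    | succ k ih =>
      obtain ⟨hk', hr⟩ := ih (Nat.le_of_succ_le hk)
      have hmem : pt (k + 1 : ℕ) 0 ∈ meshVertices (squareDomain L) 1 := by
        rw [hV, pt_mem_squareSites_iff]
        exact ⟨⟨by positivity, by exact_mod_cast hk⟩, le_rfl, by positivity⟩
      refine ⟨hmem, hr.trans (SimpleGraph.Adj.reachable ?_)⟩
      simp only [hG, SimpleGraph.comap_adj, Function.Embedding.coe_subtype]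
      refine meshGraph_adj_of_mem_squareSites (hV ▸ hk') (hV ▸ hmem) ?_
      rw [LatticeModels.zdGraph_adj_iff]
      refine ⟨0, Or.inl ?_⟩
      push_cast
      exact pt_succ_eq k 0
  -- then up the column
  have hcol : ∀ (i : ℕ) (k : ℕ), i ≤ L → k ≤ L →
      ∃ h : pt i k ∈ meshVertices (squareDomain L) 1, G.Reachable ⟨pt 0 0, h00⟩ ⟨pt i k, h⟩ := by
    intro i k hi hk
    induction k with
    | zero => obtain ⟨h, hr⟩ := hrow i hi; exact ⟨by exact_mod_cast h, by exact_mod_cast hr⟩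
    | succ k ih =>
      obtain ⟨hk', hr⟩ := ih (Nat.le_of_succ_le hk)
      have hmem : pt i (k + 1 : ℕ) ∈ meshVertices (squareDomain L) 1 := by
        rw [hV, pt_mem_squareSites_iff]
        exact ⟨⟨by positivity, by exact_mod_cast hi⟩, by positivity, by exact_mod_cast hk⟩
      refine ⟨hmem, hr.trans (SimpleGraph.Adj.reachable ?_)⟩
      simp only [hG, SimpleGraph.comap_adj, Function.Embedding.coe_subtype]
      refine meshGraph_adj_of_mem_squareSites (hV ▸ hk') (hV ▸ hmem) ?_
      rw [LatticeModels.zdGraph_adj_iff]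
      refine ⟨1, Or.inl ?_⟩
      push_cast
      exact pt_succ_eq' i k
  -- every mesh vertex is some `pt i k`
  have hreach : ∀ v : meshVertices (squareDomain L) 1, G.Reachable ⟨pt 0 0, h00⟩ v := by
    rintro ⟨v, hv⟩
    have hv' := hv
    rw [hV, mem_squareSites_iff] at hv'
    obtain ⟨i, hi⟩ : ∃ i : ℕ, (i : ℤ) = v 0 := ⟨(v 0).toNat, Int.toNat_of_nonneg (hv' 0).1⟩
    obtain ⟨k, hk⟩ : ∃ k : ℕ, (k : ℤ) = v 1 := ⟨(v 1).toNat, Int.toNat_of_nonneg (hv' 1).1⟩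
    have hiL : i ≤ L := by have := (hv' 0).2; omega
    have hkL : k ≤ L := by have := (hv' 1).2; omega
    obtain ⟨h, hr⟩ := hcol i k hiL hkL
    have heq : pt i k = v := by
      ext j; fin_cases j
      · simpa [pt] using hi
      · simpa [pt] using hk
    have hsub : (⟨v, hv⟩ : meshVertices (squareDomain L) 1) = ⟨pt i k, h⟩ := Subtype.ext heq.symm
    rw [hsub]
    exact hr
  exact fun u v => (hreach u).symm.trans (hreach v)

/-- **The discrete domain of the square is the whole set of sites `{0, …, L}²`.** [folklore] -/
theorem meshDomain_squareDomain (L : ℕ) : meshDomain (squareDomain L) 1 = squareSites L := by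
  rw [meshDomain_eq_meshVertices_of_preconnected (meshVertexGraph_squareDomain_preconnected L),
    meshVertices_squareDomain]

/-- **Adjacency in the discrete domain of the square** is lattice adjacency between sites of the
square. [folklore] -/
theorem discreteDomainGraph_squareDomain_adj_iff {L : ℕ} {x y : Site 2} :
    (discreteDomainGraph (squareDomain L) 1).Adj x y ↔
      (zdGraph 2).Adj x y ∧ x ∈ squareSites L ∧ y ∈ squareSites L := by
  rw [discreteDomainGraph_adj_iff, meshDomain_squareDomain]
  constructor
  · rintro ⟨h, hx, hy⟩
    exact ⟨(meshGraph_adj_iff.1 h).1, hx, hy⟩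
  · rintro ⟨h, hx, hy⟩
    exact ⟨meshGraph_adj_of_mem_squareSites hx hy h, hx, hy⟩

/-! ### The Dobrushin data: wired arc = left side with two unit hooks -/

/-- **The wired arc `A`**: the left side `{re = -1/2}` of `∂Ω_L` together with the two hooks
`{im = -1/2, re ≤ 1/2}` and `{im = L + 1/2, re ≤ 1/2}` of length one along the bottom and top
sides (the hooks break the ties at the corner sites `(0, 0)`, `(0, L)`, which would otherwise be
equidistant from the left side and from the bottom/top sides). Garban's `∂₀Q` up to the two
corner sites. [cite: SchrammSmirnov2011, Appendix B, proof of Lemma B.1 (open boundary conditions on the side ∂₀Q)] -/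
def squareArcA (L : ℕ) : Set ℂ :=
  {z | z.re = -(1 / 2 : ℝ) ∧ -(1 / 2 : ℝ) ≤ z.im ∧ z.im ≤ L + 1 / 2} ∪
    {z | z.im = -(1 / 2 : ℝ) ∧ -(1 / 2 : ℝ) ≤ z.re ∧ z.re ≤ 1 / 2} ∪
    {z | z.im = (L : ℝ) + 1 / 2 ∧ -(1 / 2 : ℝ) ≤ z.re ∧ z.re ≤ 1 / 2}

/-- **Garban's square as discrete Dobrushin data** at mesh `1`: the open square
`(-1/2, L+1/2)²`, the wired arc `squareArcA L` and the dual-wired arc its complement in the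
topological boundary ("dual closed on the complementary three sides"). [cite: SchrammSmirnov2011, Appendix B, proof of Lemma B.1 (Q with its boundary conditions)] -/
def squareDobrushin (L : ℕ) : DiscreteDobrushin where
  Ω := squareDomain L
  δ := 1
  arcA := squareArcA L
  arcB := frontier (squareDomain L) \ squareArcA L

/-- The domain of the data is the square. [folklore] -/
@[simp] theorem squareDobrushin_Ω (L : ℕ) : (squareDobrushin L).Ω = squareDomain L := rfl

/-- The mesh of the data is `1`. [folklore] -/
@[simp] theorem squareDobrushin_δ (L : ℕ) : (squareDobrushin L).δ = 1 := rfl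

/-- The wired arc of the data. [folklore] -/
@[simp] theorem squareDobrushin_arcA (L : ℕ) : (squareDobrushin L).arcA = squareArcA L := rfl

/-- The dual-wired arc of the data. [folklore] -/
@[simp] theorem squareDobrushin_arcB (L : ℕ) :
    (squareDobrushin L).arcB = frontier (squareDomain L) \ squareArcA L := rfl

/-! ### Inner faces and the discrete boundary of the square -/

/-- `f + eᵢ` is a corner of the face `f` (a special case of the tree's `isCorner_add_single`,
`InterfaceTraversalBound.lean`, reproved to keep the imports light). [folklore] -/
private theorem isCorner_add_single_one (f : Site 2) (i : Fin 2) : IsCorner (f + Pi.single i 1) f := by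
  intro j
  by_cases h : j = i
  · subst h; right; simp
  · left; simp [h]

/-- **The inner faces of the square** are the faces `f` with `0 ≤ f i` and `f i + 1 ≤ L`
(all four corners in `{0, …, L}²`). [folklore] -/
theorem isInnerFace_squareDobrushin_iff {L : ℕ} {f : Site 2} :
    (squareDobrushin L).IsInnerFace f ↔ ∀ i, 0 ≤ f i ∧ f i + 1 ≤ L := by
  constructor
  · intro h i
    have hadj : (zdGraph 2).Adj f (f + Pi.single i 1) :=
      (LatticeModels.zdGraph_adj_iff _ _).2 ⟨i, Or.inl rfl⟩
    have := h f (f + Pi.single i 1) (isCorner_self f) (isCorner_add_single_one f i) hadj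
    rw [squareDobrushin_Ω, squareDobrushin_δ, discreteDomainGraph_squareDomain_adj_iff] at this
    obtain ⟨-, hf, hf'⟩ := this
    have h1 := (mem_squareSites_iff.1 hf) i
    have h2 := (mem_squareSites_iff.1 hf') i
    simp only [Pi.add_apply, Pi.single_eq_same] at h2
    exact ⟨h1.1, h2.2⟩
  · intro h v w hv hw hadj
    rw [squareDobrushin_Ω, squareDobrushin_δ, discreteDomainGraph_squareDomain_adj_iff]
    have hmem : ∀ u, IsCorner u f → u ∈ squareSites L := fun u hu =>
      mem_squareSites_iff.2 fun i => by
        rcases hu i with h' | h' <;> · rw [h']; have := h i; omega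
    exact ⟨hadj, hmem v hv, hmem w hw⟩

/-- **The discrete boundary of the square** (for `L ≥ 1`) is its outer layer: the sites of
`{0, …, L}²` with a coordinate in `{0, L}`. [folklore] -/
theorem mem_zdBoundary_squareDobrushin_iff {L : ℕ} {x : Site 2} :
    x ∈ (squareDobrushin L).zdBoundary ↔ x ∈ squareSites L ∧ ∃ i, x i = 0 ∨ x i = L := by
  constructor
  · rintro (hx | ⟨y, hxy, -, f, hf, hxf, -⟩)
    · -- vertex boundary: a lattice neighbour outside the square
      rw [mem_meshBoundary_iff, squareDobrushin_Ω, squareDobrushin_δ, meshDomain_squareDomain] at hx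
      obtain ⟨hx, y, hxy, hnadj⟩ := hx
      rw [discreteDomainGraph_squareDomain_adj_iff] at hnadj
      have hy : y ∉ squareSites L := fun hy => hnadj ⟨hxy, hx, hy⟩
      refine ⟨hx, ?_⟩
      rw [mem_squareSites_iff, not_forall] at hy
      obtain ⟨i, hi⟩ := hy
      refine ⟨i, ?_⟩
      have h1 := (mem_squareSites_iff.1 hx) i
      obtain ⟨j, hj | hj⟩ := (LatticeModels.zdGraph_adj_iff _ _).1 hxy
      · have : y i = x i + (Pi.single j (1 : ℤ) : Site 2) i := by rw [hj]; rfl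
        rw [Pi.single_apply] at this
        split_ifs at this <;> omega
      · have : x i = y i + (Pi.single j (1 : ℤ) : Site 2) i := by rw [hj]; rfl
        rw [Pi.single_apply] at this
        split_ifs at this <;> omega
    · -- a corner of a non-inner face
      have hx : x ∈ squareSites L := by
        rw [squareDobrushin_Ω, squareDobrushin_δ, discreteDomainGraph_squareDomain_adj_iff] at hxy
        exact hxy.2.1
      refine ⟨hx, ?_⟩
      rw [isInnerFace_squareDobrushin_iff, not_forall] at hf
      obtain ⟨i, hi⟩ := hf
      refine ⟨i, ?_⟩
      have h1 := (mem_squareSites_iff.1 hx) i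
      rcases hxf i with h2 | h2 <;> omega
  · rintro ⟨hx, i, hi⟩
    left
    rw [mem_meshBoundary_iff, squareDobrushin_Ω, squareDobrushin_δ, meshDomain_squareDomain]
    refine ⟨hx, ?_⟩
    rcases hi with hi | hi
    · refine ⟨x - Pi.single i 1, (LatticeModels.zdGraph_adj_iff _ _).2 ⟨i, Or.inr (by simp)⟩, ?_⟩
      rw [discreteDomainGraph_squareDomain_adj_iff]
      rintro ⟨-, -, hy⟩
      have := (mem_squareSites_iff.1 hy) i
      simp only [Pi.sub_apply, Pi.single_eq_same] at this
      omega
    · refine ⟨x + Pi.single i 1, (LatticeModels.zdGraph_adj_iff _ _).2 ⟨i, Or.inl rfl⟩, ?_⟩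
      rw [discreteDomainGraph_squareDomain_adj_iff]
      rintro ⟨-, -, hy⟩
      have := (mem_squareSites_iff.1 hy) i
      simp only [Pi.add_apply, Pi.single_eq_same] at this
      omega

/-! ### The discrete arcs of the square -/

/-- A lower bound on all distances bounds the infimum distance from below. [folklore] -/
theorem le_infDist_of_forall {α : Type*} [PseudoMetricSpace α] {x : α} {s : Set α} {r : ℝ}
    (hs : s.Nonempty) (h : ∀ y ∈ s, r ≤ dist x y) : r ≤ infDist x s := by
  by_contra hlt
  rw [not_le] at hlt
  obtain ⟨y, hy, hyr⟩ := (infDist_lt_iff hs).1 hlt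
  exact (h y hy).not_gt hyr

/-- **Two half-unit offsets give distance at least `3/5`**: if the real parts differ by at least
`1/2` and the imaginary parts by at least `1/2`, the distance is at least `3/5 (< √2/2)`.
[folklore] -/
theorem dist_ge_of_abs_re_abs_im {z w : ℂ} (hre : 1 / 2 ≤ |z.re - w.re|) (him : 1 / 2 ≤ |z.im - w.im|) :
    3 / 5 ≤ dist z w := by
  rw [Complex.dist_eq_re_im]
  rw [Real.le_sqrt' (by norm_num)]
  nlinarith [sq_abs (z.re - w.re), sq_abs (z.im - w.im), abs_nonneg (z.re - w.re),
    abs_nonneg (z.im - w.im)]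

/-- The real parts bound the distance from below. [folklore] -/
theorem abs_re_sub_le_dist (z w : ℂ) : |z.re - w.re| ≤ dist z w := by
  rw [Complex.dist_eq]
  simpa using Complex.abs_re_le_norm (z - w)

/-- An integer and a half-integer differ by at least `1/2` (the tree's `half_le_abs_int_sub_half`,
`MedialGridDistances.lean`, reproved to keep the imports light). [folklore] -/
private theorem half_le_abs_int_sub_half_aux (n : ℤ) (s : ℤ) : (1 / 2 : ℝ) ≤ |(n : ℝ) - (s + 1 / 2)| := by
  rcases le_or_gt n s with h | h
  · have : (n : ℝ) ≤ s := by exact_mod_cast h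
    rw [abs_of_nonpos (by linarith)]; linarith
  · have : (s : ℝ) + 1 ≤ n := by exact_mod_cast h
    rw [abs_of_nonneg (by linarith)]; linarith

/-- **The topological boundary of the square**: the four sides. [folklore] -/
theorem frontier_squareDomain (L : ℕ) :
    frontier (squareDomain L) =
      Set.Icc (-(1 / 2 : ℝ)) (L + 1 / 2) ×ℂ {-(1 / 2 : ℝ), (L : ℝ) + 1 / 2} ∪
        {-(1 / 2 : ℝ), (L : ℝ) + 1 / 2} ×ℂ Set.Icc (-(1 / 2 : ℝ)) (L + 1 / 2) := by
  have hlt : (-(1 / 2 : ℝ)) < L + 1 / 2 := by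
    have : (0 : ℝ) ≤ L := by positivity
    linarith
  rw [squareDomain, frontier_reProdIm, closure_Ioo hlt.ne, frontier_Ioo hlt]

/-- Membership in the boundary of the square, in coordinates. [folklore] -/
theorem mem_frontier_squareDomain_iff {L : ℕ} {z : ℂ} :
    z ∈ frontier (squareDomain L) ↔
      ((-(1 / 2 : ℝ) ≤ z.re ∧ z.re ≤ L + 1 / 2) ∧ (z.im = -(1 / 2 : ℝ) ∨ z.im = L + 1 / 2)) ∨
        ((z.re = -(1 / 2 : ℝ) ∨ z.re = L + 1 / 2) ∧ (-(1 / 2 : ℝ) ≤ z.im ∧ z.im ≤ L + 1 / 2)) := by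
  rw [frontier_squareDomain]
  simp only [Set.mem_union, mem_reProdIm, Set.mem_Icc, Set.mem_insert_iff, Set.mem_singleton_iff]

/-- The wired arc lies on the topological boundary. [folklore] -/
theorem squareArcA_subset_frontier (L : ℕ) : squareArcA L ⊆ frontier (squareDomain L) := by
  intro z hz
  rw [mem_frontier_squareDomain_iff]
  have hL : (0 : ℝ) ≤ L := by positivity
  rcases hz with (⟨hre, h1, h2⟩ | ⟨him, h1, h2⟩) | ⟨him, h1, h2⟩
  · exact Or.inr ⟨Or.inl hre, h1, h2⟩
  · exact Or.inl ⟨⟨h1, by linarith⟩, Or.inl him⟩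
  · exact Or.inl ⟨⟨h1, by linarith⟩, Or.inr him⟩

/-- Points of the wired arc have real part at most `1/2`. [folklore] -/
theorem re_le_half_of_mem_squareArcA {L : ℕ} {z : ℂ} (hz : z ∈ squareArcA L) : z.re ≤ 1 / 2 := by
  rcases hz with (⟨hre, -, -⟩ | ⟨-, -, h2⟩) | ⟨-, -, h2⟩
  · rw [hre]; norm_num
  · exact h2
  · exact h2

/-- **Points of the dual-wired arc have real part `> 1/2`** (for `L ≥ 1`): on the bottom and top
sides the hooks take away `re ≤ 1/2`, the left side is wired, the right side has
`re = L + 1/2`. [folklore] -/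
theorem half_lt_re_of_mem_arcB {L : ℕ} (hL : 1 ≤ L) {z : ℂ}
    (hz : z ∈ frontier (squareDomain L) \ squareArcA L) : 1 / 2 < z.re := by
  obtain ⟨hzf, hzA⟩ := hz
  rw [mem_frontier_squareDomain_iff] at hzf
  have hL' : (1 : ℝ) ≤ L := by exact_mod_cast hL
  by_contra hle
  rw [not_lt] at hle
  apply hzA
  rcases hzf with ⟨⟨h1, -⟩, him | him⟩ | ⟨hre | hre, h1, h2⟩
  · exact Or.inl (Or.inr ⟨him, h1, hle⟩)
  · exact Or.inr ⟨him, h1, hle⟩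
  · exact Or.inl (Or.inl ⟨hre, h1, h2⟩)
  · exfalso; rw [hre] at hle; linarith

/-- Points of the dual-wired arc lie on the bottom, top or right side. [folklore] -/
theorem im_or_re_of_mem_arcB {L : ℕ} (hL : 1 ≤ L) {z : ℂ}
    (hz : z ∈ frontier (squareDomain L) \ squareArcA L) :
    (z.im = -(1 / 2 : ℝ) ∨ z.im = L + 1 / 2) ∨ z.re = L + 1 / 2 := by
  have hre := half_lt_re_of_mem_arcB hL hz
  have hzf := hz.1
  rw [mem_frontier_squareDomain_iff] at hzf
  rcases hzf with ⟨-, him⟩ | ⟨hre' | hre', -⟩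
  · exact Or.inl him
  · exfalso; rw [hre'] at hre; linarith
  · exact Or.inr hre'

/-- The right-side point at height `0` is on the dual-wired arc (so the latter is nonempty).
[folklore] -/
theorem right_mem_arcB {L : ℕ} (hL1 : 1 ≤ L) (t : ℝ) (ht0 : -(1 / 2 : ℝ) ≤ t) (ht1 : t ≤ L + 1 / 2) :
    (⟨(L : ℝ) + 1 / 2, t⟩ : ℂ) ∈ frontier (squareDomain L) \ squareArcA L := by
  have hL : (1 : ℝ) ≤ L := by exact_mod_cast hL1
  refine ⟨mem_frontier_squareDomain_iff.2 (Or.inr ⟨Or.inr rfl, ht0, ht1⟩), fun h => ?_⟩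
  have := re_le_half_of_mem_squareArcA h
  simp only at this
  linarith

/-- The mesh point of a site at mesh `1`, in coordinates. [folklore] -/
theorem meshPoint_one_eq (x : Site 2) : meshPoint 1 x = ⟨(x 0 : ℝ), (x 1 : ℝ)⟩ :=
  Complex.ext (by simp) (by simp)

/-- **Left column: the wired arc is within `1/2`.** [folklore] -/
theorem infDist_arcA_le_of_left {L : ℕ} {x : Site 2} (hx : x ∈ squareSites L) (h0 : x 0 = 0) :
    infDist (meshPoint 1 x) (squareArcA L) ≤ 1 / 2 := by
  have hx1 := (mem_squareSites_iff.1 hx) 1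
  have hL : (0 : ℝ) ≤ L := by positivity
  have ha : (⟨-(1 / 2 : ℝ), (x 1 : ℝ)⟩ : ℂ) ∈ squareArcA L := by
    refine Or.inl (Or.inl ⟨rfl, ?_, ?_⟩) <;> simp only
    · have : (0 : ℝ) ≤ x 1 := by exact_mod_cast hx1.1
      linarith
    · have : (x 1 : ℝ) ≤ L := by exact_mod_cast hx1.2
      linarith
  refine (infDist_le_dist_of_mem ha).trans (le_of_eq ?_)
  rw [meshPoint_one_eq, Complex.dist_of_im_eq (by simp), Real.dist_eq]
  simp [h0]

/-- **Left column: the dual-wired arc is at distance `≥ 3/5`.** [folklore] -/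
theorem le_infDist_arcB_of_left {L : ℕ} (hL : 1 ≤ L) {x : Site 2} (h0 : x 0 = 0) :
    3 / 5 ≤ infDist (meshPoint 1 x) (frontier (squareDomain L) \ squareArcA L) := by
  have hL' : (1 : ℝ) ≤ L := by exact_mod_cast hL
  refine le_infDist_of_forall ⟨_, right_mem_arcB hL 0 (by norm_num) (by linarith)⟩ fun z hz => ?_
  have hre := half_lt_re_of_mem_arcB hL hz
  rcases im_or_re_of_mem_arcB hL hz with him | hre'
  · refine dist_ge_of_abs_re_abs_im ?_ ?_
    · rw [meshPoint_re, one_mul, h0]; push_cast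
      rw [abs_of_nonpos (by linarith)]; linarith
    · rw [meshPoint_im, one_mul]
      rcases him with him | him
      · rw [him]
        have := half_le_abs_int_sub_half_aux (x 1) (-1)
        push_cast at this
        convert this using 2; ring
      · rw [him]
        have := half_le_abs_int_sub_half_aux (x 1) L
        push_cast at this
        exact this
  · refine le_trans ?_ (abs_re_sub_le_dist _ _)
    rw [meshPoint_re, one_mul, h0, hre']; push_cast
    rw [abs_of_nonpos (by linarith)]; linarith

/-- **Off the left column: the dual-wired arc is within `1/2`** of every site of the outer
layer. [folklore] -/
theorem infDist_arcB_le_of_not_left {L : ℕ} {x : Site 2} (hx : x ∈ squareSites L)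
    (hlayer : ∃ i, x i = 0 ∨ x i = L) (h0 : x 0 ≠ 0) :
    infDist (meshPoint 1 x) (frontier (squareDomain L) \ squareArcA L) ≤ 1 / 2 := by
  have hx0 := (mem_squareSites_iff.1 hx) 0
  have hx1 := (mem_squareSites_iff.1 hx) 1
  have hL : (0 : ℝ) ≤ L := by positivity
  have h0' : (1 : ℤ) ≤ x 0 := by omega
  have h0r : (1 : ℝ) ≤ x 0 := by exact_mod_cast h0'
  have hx0r : (x 0 : ℝ) ≤ L := by exact_mod_cast hx0.2
  have hx1r : (0 : ℝ) ≤ x 1 := by exact_mod_cast hx1.1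
  have hx1r' : (x 1 : ℝ) ≤ L := by exact_mod_cast hx1.2
  -- not in the wired arc: real part `≥ 1 > 1/2`, or on the right side off the hooks
  have hnotA : ∀ z : ℂ, 1 / 2 < z.re → z ∉ squareArcA L := fun z hz h =>
    absurd (re_le_half_of_mem_squareArcA h) (not_le.2 hz)
  obtain ⟨i, hi⟩ := hlayer
  fin_cases i
  · -- `x 0 = L` (since `x 0 ≠ 0`): the right side
    have hxL : x 0 = L := by simpa using hi.resolve_left h0
    have hL1 : 1 ≤ L := by
      have : (1 : ℤ) ≤ L := by rw [← hxL]; exact h0'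
      exact_mod_cast this
    have hz : (⟨(L : ℝ) + 1 / 2, (x 1 : ℝ)⟩ : ℂ) ∈ frontier (squareDomain L) \ squareArcA L :=
      right_mem_arcB hL1 _ (by linarith) (by linarith)
    refine (infDist_le_dist_of_mem hz).trans (le_of_eq ?_)
    rw [meshPoint_one_eq, Complex.dist_of_im_eq (by simp), Real.dist_eq]
    simp only
    rw [hxL]; push_cast
    rw [abs_of_nonpos (by linarith)]; ring
  · -- bottom or top row
    rcases hi with hi | hi
    · have hz : (⟨(x 0 : ℝ), -(1 / 2 : ℝ)⟩ : ℂ) ∈ frontier (squareDomain L) \ squareArcA L :=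
        ⟨mem_frontier_squareDomain_iff.2 (Or.inl ⟨⟨by simp only; linarith, by simp only; linarith⟩,
          Or.inl rfl⟩), hnotA _ (by simp only; linarith)⟩
      refine (infDist_le_dist_of_mem hz).trans (le_of_eq ?_)
      rw [meshPoint_one_eq, Complex.dist_of_re_eq (by simp), Real.dist_eq]
      simp only
      have : x 1 = 0 := by simpa using hi
      rw [this]; push_cast
      rw [abs_of_nonneg (by norm_num)]; ring
    · have hz : (⟨(x 0 : ℝ), (L : ℝ) + 1 / 2⟩ : ℂ) ∈ frontier (squareDomain L) \ squareArcA L :=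
        ⟨mem_frontier_squareDomain_iff.2 (Or.inl ⟨⟨by simp only; linarith, by simp only; linarith⟩,
          Or.inr rfl⟩), hnotA _ (by simp only; linarith)⟩
      refine (infDist_le_dist_of_mem hz).trans (le_of_eq ?_)
      rw [meshPoint_one_eq, Complex.dist_of_re_eq (by simp), Real.dist_eq]
      simp only
      have : x 1 = L := by simpa using hi
      rw [this]; push_cast
      rw [abs_of_nonpos (by linarith)]; ring

/-- **Off the left column: the wired arc is at distance `≥ 3/5`.** [folklore] -/
theorem le_infDist_arcA_of_not_left {L : ℕ} {x : Site 2} (hx : x ∈ squareSites L) (h0 : x 0 ≠ 0) :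
    3 / 5 ≤ infDist (meshPoint 1 x) (squareArcA L) := by
  have hx0 := (mem_squareSites_iff.1 hx) 0
  have h0' : (1 : ℤ) ≤ x 0 := by omega
  have h0r : (1 : ℝ) ≤ x 0 := by exact_mod_cast h0'
  have hL : (0 : ℝ) ≤ L := by positivity
  have hne : (squareArcA L).Nonempty := ⟨⟨-(1 / 2 : ℝ), 0⟩, Or.inl (Or.inl ⟨rfl, by simp, by
    simp only; linarith⟩)⟩
  refine le_infDist_of_forall hne fun a ha => ?_
  rcases ha with (⟨hre, -, -⟩ | ⟨him, -, h2⟩) | ⟨him, -, h2⟩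
  · refine le_trans ?_ (abs_re_sub_le_dist _ _)
    rw [meshPoint_re, one_mul, hre, abs_of_nonneg (by linarith)]; linarith
  · refine dist_ge_of_abs_re_abs_im ?_ ?_
    · rw [meshPoint_re, one_mul, abs_of_nonneg (by linarith)]; linarith
    · rw [meshPoint_im, one_mul, him]
      have := half_le_abs_int_sub_half_aux (x 1) (-1)
      push_cast at this
      convert this using 2; ring
  · refine dist_ge_of_abs_re_abs_im ?_ ?_
    · rw [meshPoint_re, one_mul, abs_of_nonneg (by linarith)]; linarith
    · rw [meshPoint_im, one_mul, him]
      have := half_le_abs_int_sub_half_aux (x 1) L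
      push_cast at this
      exact this

/-- **The discrete wired arc of the square is the left column** `{x₀ = 0}` of the outer layer
(for `L ≥ 1`). [folklore] -/
theorem mem_zdArcA_squareDobrushin_iff {L : ℕ} (hL : 1 ≤ L) {x : Site 2} :
    x ∈ (squareDobrushin L).zdArcA ↔ x ∈ squareSites L ∧ x 0 = 0 := by
  rw [DiscreteDobrushin.zdArcA, mem_zdDiscreteArc_iff, mem_zdBoundary_squareDobrushin_iff,
    squareDobrushin_Ω, squareDobrushin_δ, squareDobrushin_arcA]
  constructor
  · rintro ⟨⟨hx, hlayer⟩, hdist⟩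
    refine ⟨hx, ?_⟩
    by_contra h0
    have h1 := le_infDist_arcA_of_not_left hx h0
    have h2 := infDist_arcB_le_of_not_left hx hlayer h0
    linarith
  · rintro ⟨hx, h0⟩
    refine ⟨⟨hx, 0, Or.inl h0⟩, ?_⟩
    have h1 := infDist_arcA_le_of_left hx h0
    have h2 := le_infDist_arcB_of_left hL (x := x) h0
    linarith

/-- **The discrete dual-wired arc of the square is the rest of the outer layer** `{x₀ ≥ 1}`
(for `L ≥ 1`). [folklore] -/
theorem mem_zdArcB_squareDobrushin_iff {L : ℕ} (hL : 1 ≤ L) {x : Site 2} :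
    x ∈ (squareDobrushin L).zdArcB ↔ (x ∈ squareSites L ∧ ∃ i, x i = 0 ∨ x i = L) ∧ x 0 ≠ 0 := by
  rw [DiscreteDobrushin.zdArcB, mem_zdDiscreteArc_iff, mem_zdBoundary_squareDobrushin_iff,
    squareDobrushin_Ω, squareDobrushin_δ, squareDobrushin_arcB]
  have hfr : frontier (squareDomain L) \ (frontier (squareDomain L) \ squareArcA L) = squareArcA L := by
    rw [Set.sdiff_sdiff_right_self, Set.inter_eq_right]
    exact squareArcA_subset_frontier L
  rw [hfr]
  constructor
  · rintro ⟨⟨hx, hlayer⟩, hdist⟩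
    refine ⟨⟨hx, hlayer⟩, fun h0 => ?_⟩
    have h1 := infDist_arcA_le_of_left hx h0
    have h2 := le_infDist_arcB_of_left hL (x := x) h0
    linarith
  · rintro ⟨⟨hx, hlayer⟩, h0⟩
    refine ⟨⟨hx, hlayer⟩, ?_⟩
    have h1 := le_infDist_arcA_of_not_left hx h0
    have h2 := infDist_arcB_le_of_not_left hx hlayer h0
    linarith

/-! ### The two `A`–`B` edges and admissibility -/

/-- Coordinates of `pt` (the `Percolation.pt` of `RSW.lean`; cf. the unrelated `SAW.pt`). [folklore] -/
@[simp] theorem pt_apply_zero (i j : ℤ) : pt i j 0 = i := rfl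

/-- Coordinates of `pt`. [folklore] -/
@[simp] theorem pt_apply_one (i j : ℤ) : pt i j 1 = j := rfl

/-- Every site is `pt` of its coordinates. [folklore] -/
theorem eq_pt (x : Site 2) : x = pt (x 0) (x 1) := by
  ext k; fin_cases k <;> rfl

/-- `(0, j) ∼ (1, j)` in `ℤ²`. [folklore] -/
theorem adj_pt_zero_one (j : ℤ) : (zdGraph 2).Adj (pt 0 j) (pt 1 j) :=
  (LatticeModels.zdGraph_adj_iff _ _).2 ⟨0, Or.inl (by rw [← pt_succ_eq]; norm_num)⟩

/-- **The `A`–`B` edges of the square** (for `L ≥ 2`) are the two bottom-left and top-left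
horizontal edges `{(0,0),(1,0)}` and `{(0,L),(1,L)}` — the edges `e_a`, `e_b` at the two ends of
Garban's side `∂₀Q`. [folklore] -/
theorem zdABEdges_squareDobrushin {L : ℕ} (hL : 2 ≤ L) :
    (squareDobrushin L).zdABEdges = {s(pt 0 0, pt 1 0), s(pt 0 L, pt 1 L)} := by
  have hL1 : 1 ≤ L := by omega
  ext e
  rw [mem_zdABEdges_iff, Set.mem_insert_iff, Set.mem_singleton_iff]
  constructor
  · rintro ⟨he, ⟨u, hu, huA⟩, ⟨v, hv, hvB⟩⟩
    rw [mem_zdArcA_squareDobrushin_iff hL1] at huA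
    rw [mem_zdArcB_squareDobrushin_iff hL1] at hvB
    obtain ⟨huS, hu0⟩ := huA
    obtain ⟨⟨hvS, i, hi⟩, hv0⟩ := hvB
    have huv : u ≠ v := fun h => hv0 (h ▸ hu0)
    have he' : e = s(u, v) := ((Sym2.mem_and_mem_iff huv).1 ⟨hu, hv⟩)
    rw [he', squareDobrushin_Ω, squareDobrushin_δ, SimpleGraph.mem_edgeSet,
      discreteDomainGraph_squareDomain_adj_iff] at he
    obtain ⟨hadj, -, -⟩ := he
    have hv0' := (mem_squareSites_iff.1 hvS) 0
    have hv1' := (mem_squareSites_iff.1 hvS) 1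
    have hu1' := (mem_squareSites_iff.1 huS) 1
    -- `v = u + e₀`
    obtain ⟨j, hj | hj⟩ := (LatticeModels.zdGraph_adj_iff _ _).1 hadj
    · have h0 : v 0 = u 0 + (Pi.single j (1 : ℤ) : Site 2) 0 := by rw [hj]; rfl
      have h1 : v 1 = u 1 + (Pi.single j (1 : ℤ) : Site 2) 1 := by rw [hj]; rfl
      fin_cases j
      · simp at h0 h1
        -- `v 0 = 1`, so `v` on the layer forces `v 1 ∈ {0, L}`
        have hv01 : v 0 = 1 := by omega
        fin_cases i
        · simp at hi; omega
        · simp at hi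
          rcases hi with hi | hi
          · left
            rw [he', eq_pt u, eq_pt v, hu0, hv01, hi, ← h1, hi]
          · right
            rw [he', eq_pt u, eq_pt v, hu0, hv01, hi, ← h1, hi]
      · simp at h0 h1; omega
    · have h0 : u 0 = v 0 + (Pi.single j (1 : ℤ) : Site 2) 0 := by rw [hj]; rfl
      fin_cases j
      · simp at h0; omega
      · simp at h0; omega
  · rintro (rfl | rfl)
    · refine ⟨?_, ⟨pt 0 0, Sym2.mem_mk_left _ _, ?_⟩, ⟨pt 1 0, Sym2.mem_mk_right _ _, ?_⟩⟩
      · rw [squareDobrushin_Ω, squareDobrushin_δ, SimpleGraph.mem_edgeSet,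
          discreteDomainGraph_squareDomain_adj_iff, pt_mem_squareSites_iff, pt_mem_squareSites_iff]
        exact ⟨adj_pt_zero_one 0, by omega, by omega⟩
      · rw [mem_zdArcA_squareDobrushin_iff hL1, pt_mem_squareSites_iff]
        exact ⟨by omega, rfl⟩
      · rw [mem_zdArcB_squareDobrushin_iff hL1, pt_mem_squareSites_iff]
        exact ⟨⟨by omega, 1, Or.inl rfl⟩, by simp⟩
    · refine ⟨?_, ⟨pt 0 L, Sym2.mem_mk_left _ _, ?_⟩, ⟨pt 1 L, Sym2.mem_mk_right _ _, ?_⟩⟩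
      · rw [squareDobrushin_Ω, squareDobrushin_δ, SimpleGraph.mem_edgeSet,
          discreteDomainGraph_squareDomain_adj_iff, pt_mem_squareSites_iff, pt_mem_squareSites_iff]
        exact ⟨adj_pt_zero_one L, by omega, by omega⟩
      · rw [mem_zdArcA_squareDobrushin_iff hL1, pt_mem_squareSites_iff]
        exact ⟨by omega, rfl⟩
      · rw [mem_zdArcB_squareDobrushin_iff hL1, pt_mem_squareSites_iff]
        exact ⟨⟨by omega, 1, Or.inr rfl⟩, by simp⟩

/-- The faces having both `(0, j)` and `(1, j)` as corners are `(0, j)` and `(0, j-1)`.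
[folklore] -/
theorem face_of_isCorner_pt {j : ℤ} {f : Site 2} (h0 : IsCorner (pt 0 j) f) (h1 : IsCorner (pt 1 j) f) :
    f = pt 0 j ∨ f = pt 0 (j - 1) := by
  have a0 := h0 0; have a1 := h0 1; have b0 := h1 0
  simp only [pt_apply_zero, pt_apply_one] at a0 a1 b0
  have hf0 : f 0 = 0 := by omega
  rcases a1 with a1 | a1
  · left; rw [eq_pt f, hf0, ← a1]
  · right; rw [eq_pt f, hf0]; congr 1; omega

/-- **Each `A`–`B` edge borders exactly one inner face** (for `L ≥ 1`): `{(0,0),(1,0)}` borders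
the inner face `(0,0)` and the outer face `(0,-1)`; `{(0,L),(1,L)}` borders the inner face
`(0,L-1)` and the outer face `(0,L)`. [folklore] -/
theorem zdABEdges_inner_squareDobrushin {L : ℕ} (hL : 2 ≤ L) :
    ∀ e ∈ (squareDobrushin L).zdABEdges,
      ∃! f, (squareDobrushin L).IsInnerFace f ∧ ∀ x ∈ e, IsCorner x f := by
  intro e he
  rw [zdABEdges_squareDobrushin hL, Set.mem_insert_iff, Set.mem_singleton_iff] at he
  rcases he with rfl | rfl
  · refine ⟨pt 0 0, ⟨?_, ?_⟩, ?_⟩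
    · rw [isInnerFace_squareDobrushin_iff, Fin.forall_fin_two]
      simp only [pt_apply_zero, pt_apply_one]; omega
    · intro x hx
      rcases Sym2.mem_iff.1 hx with rfl | rfl
      · exact isCorner_self _
      · have : pt 1 0 = pt 0 0 + Pi.single 0 1 := by rw [← pt_succ_eq]; norm_num
        rw [this]; exact isCorner_add_single_one _ _
    · rintro f ⟨hf, hc⟩
      have h := face_of_isCorner_pt (hc _ (Sym2.mem_mk_left _ _)) (hc _ (Sym2.mem_mk_right _ _))
      rcases h with h | h
      · exact h
      · exfalso
        rw [h, isInnerFace_squareDobrushin_iff] at hf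
        have := hf 1
        simp only [pt_apply_one] at this
        omega
  · refine ⟨pt 0 (L - 1), ⟨?_, ?_⟩, ?_⟩
    · rw [isInnerFace_squareDobrushin_iff, Fin.forall_fin_two]
      simp only [pt_apply_zero, pt_apply_one]; omega
    · intro x hx
      rcases Sym2.mem_iff.1 hx with rfl | rfl
      · intro k; fin_cases k
        · left; rfl
        · right; show (L : ℤ) = ((L : ℤ) - 1) + 1; ring
      · intro k; fin_cases k
        · right; rfl
        · right; show (L : ℤ) = ((L : ℤ) - 1) + 1; ring
    · rintro f ⟨hf, hc⟩
      have h := face_of_isCorner_pt (hc _ (Sym2.mem_mk_left _ _)) (hc _ (Sym2.mem_mk_right _ _))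
      rcases h with h | h
      · exfalso
        rw [h, isInnerFace_squareDobrushin_iff] at hf
        have := hf 1
        simp only [pt_apply_one] at this
        omega
      · exact h

/-- **Garban's square is admissible discrete Dobrushin data** (for `L ≥ 2`): bounded domain,
positive mesh, nonempty disjoint discrete arcs covering the discrete boundary (no ties, thanks to
the hooks), exactly two `A`–`B` edges, each bordering exactly one inner face. Hence the medial
exploration of every configuration is well defined (`existsUnique_medialExploration_holds`).
[cite: SchrammSmirnov2011, Appendix B, proof of Lemma B.1 (the interface γ of Q)] -/
theorem isZdAdmissible_squareDobrushin {L : ℕ} (hL : 2 ≤ L) : (squareDobrushin L).IsZdAdmissible where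
  isBounded := isBounded_squareDomain L
  delta_pos := by rw [squareDobrushin_δ]; norm_num
  zdArcA_nonempty := ⟨pt 0 0, by
    rw [mem_zdArcA_squareDobrushin_iff (by omega), pt_mem_squareSites_iff]
    exact ⟨by omega, rfl⟩⟩
  zdArcB_nonempty := ⟨pt L 0, by
    rw [mem_zdArcB_squareDobrushin_iff (by omega), pt_mem_squareSites_iff]
    refine ⟨⟨by omega, 0, Or.inr rfl⟩, ?_⟩
    simp only [pt_apply_zero]; omega⟩
  disjoint := by
    rw [Set.disjoint_left]
    intro x hA hB
    rw [mem_zdArcA_squareDobrushin_iff (by omega)] at hA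
    rw [mem_zdArcB_squareDobrushin_iff (by omega)] at hB
    exact hB.2 hA.2
  zdBoundary_subset := by
    intro x hx
    rw [mem_zdBoundary_squareDobrushin_iff] at hx
    by_cases h0 : x 0 = 0
    · left; rw [mem_zdArcA_squareDobrushin_iff (by omega)]; exact ⟨hx.1, h0⟩
    · right; rw [mem_zdArcB_squareDobrushin_iff (by omega)]; exact ⟨hx, h0⟩
  ncard_zdABEdges_eq_two := by
    rw [zdABEdges_squareDobrushin hL]
    refine Set.ncard_pair fun h => ?_
    have : pt 0 0 ∈ s(pt 0 (L : ℤ), pt 1 L) := by rw [← h]; exact Sym2.mem_mk_left _ _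
    rcases Sym2.mem_iff.1 this with h' | h'
    · have := congrFun h' 1; simp at this; omega
    · have := congrFun h' 0; simp at this
  zdABEdges_inner := zdABEdges_inner_squareDobrushin hL

end Literature.Probability.Percolation
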